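import Literature.MathematicalPhysics.QuantumManyBody.BoseEinsteinCondensation
import Mathlib.Analysis.Calculus.FDeriv.Mul
import Mathlib.Analysis.Calculus.FDeriv.Prod
import Mathlib.Analysis.Calculus.ContDiff.Operations
import Mathlib.Algebra.BigOperators.Ring.Finset
import HarnessLib

/-!
# Crux `OneBodyEntropyBound` (stmt-AtomisticToContinuum-13440), line `registered`: stub `stub_productJastrow`

Route `BECCellInformation`, problem `BoseEinsteinCondensation` of the summit `AtomisticToContinuum`;
support file for the line's skeleton (namespace `…Cruxes.OneBodyEntropyBound.Birth`).

**Statement** (`stub_productJastrow`, PRODUCT JASTROW FACTOR). Let `f : ℝ³ → [0,1]` be `C¹` with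
`‖∇f(z)‖ ≤ 1 − f(z)` for all `z` (operator norm of `fderiv`). For `n` frozen particles
`x₁, …, xₙ = X 1, …, X n` and a new particle `x₀ = X 0` of a configuration `X : Config (n+1)`, the
product Jastrow factor `F(X) = ∏_{j<n} f(x₀ − x_{j+1})` is `C¹` on configuration space, takes values in
`[0,1]`, its derivative in the direction moving particle `0` by `w` is bounded by `(1 − F(X)) ‖w‖`, its
derivative in the direction moving particle `j+1` by `w` is bounded by `(1 − f(x₀ − x_{j+1})) ‖w‖`, and
its deficiency satisfies the union bound `1 − F(X) ≤ ∑_j (1 − f(x₀ − x_{j+1}))`.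

**Proof.** Each factor is `f` composed with the continuous linear map `X ↦ X 0 − X (j+1)`, so `F` is a
finite product of `C¹` functions and the Leibniz rule (`HasFDerivAt.finsetProd`) gives
`DF(X) V = ∑_j (∏_{i≠j} f(x₀ − x_{i+1})) · Df(x₀ − x_{j+1}) (V 0 − V (j+1))`.
For `V = Pi.single 0 w` every increment is `w`, each term is at most `(∏_{i≠j} aᵢ)(1 − aⱼ)‖w‖` with
`aᵢ = f(x₀ − x_{i+1}) ∈ [0,1]`, and the elementary "exactly one ≤ at least one" inequality
`∑_j (∏_{i≠j} aᵢ)(1 − aⱼ) ≤ 1 − ∏ᵢ aᵢ` (induction on the index set) concludes. For `V = Pi.single (j+1) w`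
only the `j`-th increment is nonzero (it is `−w`), and `∏_{i≠j} aᵢ ≤ 1`. The union bound
`1 − ∏ aᵢ ≤ ∑ (1 − aᵢ)` is again an induction. Elementary; `[folklore]` throughout; no definitions.
-/

noncomputable section

namespace Summit.AtomisticToContinuum.BoseEinsteinCondensation.Cruxes.OneBodyEntropyBound.Birth

open Finset
open scoped BigOperators
open Literature.MathematicalPhysics.QuantumManyBody.BoseGas

namespace ProductJastrow

/-! ### Two elementary inequalities for numbers in `[0,1]` -/

/-- Union bound: `1 - ∏ᵢ aᵢ ≤ ∑ᵢ (1 - aᵢ)` for `aᵢ ∈ [0,1]`. [folklore] -/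
theorem one_sub_prod_le_sum {ι : Type*} (s : Finset ι) (a : ι → ℝ)
    (ha : ∀ i ∈ s, 0 ≤ a i ∧ a i ≤ 1) :
    1 - ∏ i ∈ s, a i ≤ ∑ i ∈ s, (1 - a i) := by
  classical
  induction s using Finset.induction_on with
  | empty => simp
  | insert b s hb ih =>
    have hs : ∀ i ∈ s, 0 ≤ a i ∧ a i ≤ 1 := fun i hi => ha i (Finset.mem_insert_of_mem hi)
    have hP1 : ∏ i ∈ s, a i ≤ 1 :=
      Finset.prod_le_one (fun i hi => (hs i hi).1) fun i hi => (hs i hi).2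
    have hb1 : a b ≤ 1 := (ha b (Finset.mem_insert_self b s)).2
    have ih' := ih hs
    rw [Finset.prod_insert hb, Finset.sum_insert hb]
    nlinarith [mul_nonneg (sub_nonneg.2 hb1) (sub_nonneg.2 hP1)]

/-- Exactly one versus at least one: `∑ⱼ (∏_{i ≠ j} aᵢ) (1 - aⱼ) ≤ 1 - ∏ᵢ aᵢ` for `aᵢ ∈ [0,1]`.
[folklore] -/
theorem sum_prod_erase_mul_one_sub_le {ι : Type*} [DecidableEq ι] (s : Finset ι) (a : ι → ℝ)
    (ha : ∀ i ∈ s, 0 ≤ a i ∧ a i ≤ 1) :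
    ∑ j ∈ s, (∏ i ∈ s.erase j, a i) * (1 - a j) ≤ 1 - ∏ i ∈ s, a i := by
  induction s using Finset.induction_on with
  | empty => simp
  | insert b s hb ih =>
    have hs : ∀ i ∈ s, 0 ≤ a i ∧ a i ≤ 1 := fun i hi => ha i (Finset.mem_insert_of_mem hi)
    have hP1 : ∏ i ∈ s, a i ≤ 1 :=
      Finset.prod_le_one (fun i hi => (hs i hi).1) fun i hi => (hs i hi).2
    have hb0 : 0 ≤ a b := (ha b (Finset.mem_insert_self b s)).1
    have hb1 : a b ≤ 1 := (ha b (Finset.mem_insert_self b s)).2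
    have ih' := ih hs
    rw [Finset.sum_insert hb, Finset.prod_insert hb, Finset.erase_insert hb]
    have hrew : ∑ j ∈ s, (∏ i ∈ (insert b s).erase j, a i) * (1 - a j) =
        a b * ∑ j ∈ s, (∏ i ∈ s.erase j, a i) * (1 - a j) := by
      rw [Finset.mul_sum]
      refine Finset.sum_congr rfl fun j hj => ?_
      have hbj : b ≠ j := fun h => hb (h ▸ hj)
      rw [Finset.erase_insert_of_ne hbj,
        Finset.prod_insert fun h => hb (Finset.mem_of_mem_erase h)]
      ring
    rw [hrew]
    have h1 : a b * ∑ j ∈ s, (∏ i ∈ s.erase j, a i) * (1 - a j) ≤ a b * (1 - ∏ i ∈ s, a i) :=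
      mul_le_mul_of_nonneg_left ih' hb0
    nlinarith [mul_nonneg (sub_nonneg.2 hb1) (sub_nonneg.2 hP1)]

/-! ### Calculus of the product Jastrow factor -/

section Calculus

variable (f : Space → ℝ) (n : ℕ)

/-- Each factor `X ↦ f (X 0 - X (j+1))` is `C¹` when `f` is. [folklore] -/
theorem contDiff_factor (hf : ContDiff ℝ 1 f) (j : Fin n) :
    ContDiff ℝ 1 fun X : Config (n + 1) => f (X 0 - X j.succ) :=
  hf.comp ((contDiff_apply ℝ Space (0 : Fin (n + 1))).sub (contDiff_apply ℝ Space j.succ))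

/-- The product Jastrow factor is `C¹`. [folklore] -/
theorem contDiff_prodFactor (hf : ContDiff ℝ 1 f) :
    ContDiff ℝ 1 fun X : Config (n + 1) => ∏ j : Fin n, f (X 0 - X j.succ) :=
  contDiff_prod fun j _ => contDiff_factor f n hf j

/-- Chain rule for one factor: `D(f(x₀ − x_{j+1}))(X) = Df(x₀ − x_{j+1}) ∘ (V ↦ V 0 − V (j+1))`.
[folklore] -/
theorem hasFDerivAt_factor (hf : ContDiff ℝ 1 f) (j : Fin n) (X : Config (n + 1)) :
    HasFDerivAt (fun X : Config (n + 1) => f (X 0 - X j.succ))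
      ((fderiv ℝ f (X 0 - X j.succ)).comp
        (ContinuousLinearMap.proj (R := ℝ) (φ := fun _ : Fin (n + 1) => Space) 0 -
          ContinuousLinearMap.proj (R := ℝ) (φ := fun _ : Fin (n + 1) => Space) j.succ)) X :=
  ((hf.differentiable one_ne_zero) (X 0 - X j.succ)).hasFDerivAt.comp X
    ((hasFDerivAt_apply (0 : Fin (n + 1)) X).sub (hasFDerivAt_apply j.succ X))

/-- Leibniz rule for the product Jastrow factor. [folklore] -/
theorem hasFDerivAt_prodFactor (hf : ContDiff ℝ 1 f) (X : Config (n + 1)) :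
    HasFDerivAt (fun X : Config (n + 1) => ∏ j : Fin n, f (X 0 - X j.succ))
      (∑ j : Fin n, (∏ i ∈ univ.erase j, f (X 0 - X i.succ)) •
        (fderiv ℝ f (X 0 - X j.succ)).comp
          (ContinuousLinearMap.proj (R := ℝ) (φ := fun _ : Fin (n + 1) => Space) 0 -
            ContinuousLinearMap.proj (R := ℝ) (φ := fun _ : Fin (n + 1) => Space) j.succ)) X :=
  HasFDerivAt.finsetProd (u := univ) (g := fun (j : Fin n) (X : Config (n + 1)) => f (X 0 - X j.succ))
    fun j _ => hasFDerivAt_factor f n hf j X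

/-- The Leibniz rule, evaluated on a tangent vector `V`:
`DF(X) V = ∑ⱼ (∏_{i ≠ j} f(x₀ − x_{i+1})) · Df(x₀ − x_{j+1}) (V 0 − V (j+1))`. [folklore] -/
theorem fderiv_prodFactor_apply (hf : ContDiff ℝ 1 f) (X V : Config (n + 1)) :
    fderiv ℝ (fun X : Config (n + 1) => ∏ j : Fin n, f (X 0 - X j.succ)) X V =
      ∑ j : Fin n, (∏ i ∈ univ.erase j, f (X 0 - X i.succ)) *
        fderiv ℝ f (X 0 - X j.succ) (V 0 - V j.succ) := by
  rw [(hasFDerivAt_prodFactor f n hf X).fderiv, _root_.sum_apply]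
  refine Finset.sum_congr rfl fun j _ => ?_
  simp only [_root_.smul_apply, ContinuousLinearMap.comp_apply, _root_.sub_apply,
    ContinuousLinearMap.proj_apply, smul_eq_mul]

/-- One term of the Leibniz sum: `|(∏_{i≠j} aᵢ) · Df(z) u| ≤ (∏_{i≠j} aᵢ)(1 − f z)‖u‖`. [folklore] -/
theorem norm_term_le (h01 : ∀ z, 0 ≤ f z ∧ f z ≤ 1) (hdf : ∀ z, ‖fderiv ℝ f z‖ ≤ 1 - f z)
    (X : Config (n + 1)) (j : Fin n) (u : Space) :
    ‖(∏ i ∈ univ.erase j, f (X 0 - X i.succ)) * fderiv ℝ f (X 0 - X j.succ) u‖ ≤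
      (∏ i ∈ univ.erase j, f (X 0 - X i.succ)) * ((1 - f (X 0 - X j.succ)) * ‖u‖) := by
  have hP0 : 0 ≤ ∏ i ∈ univ.erase j, f (X 0 - X i.succ) :=
    Finset.prod_nonneg fun i _ => (h01 _).1
  rw [norm_mul, Real.norm_of_nonneg hP0]
  gcongr
  exact (ContinuousLinearMap.le_opNorm _ _).trans
    (mul_le_mul_of_nonneg_right (hdf _) (norm_nonneg _))

/-- Moving the new particle: `|DF(X) (Pi.single 0 w)| ≤ (1 − F(X)) ‖w‖`. [folklore] -/
theorem norm_fderiv_prodFactor_single_zero_le (hf : ContDiff ℝ 1 f) (h01 : ∀ z, 0 ≤ f z ∧ f z ≤ 1)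
    (hdf : ∀ z, ‖fderiv ℝ f z‖ ≤ 1 - f z) (X : Config (n + 1)) (w : Space) :
    ‖fderiv ℝ (fun X : Config (n + 1) => ∏ j : Fin n, f (X 0 - X j.succ)) X (Pi.single 0 w)‖ ≤
      (1 - ∏ j : Fin n, f (X 0 - X j.succ)) * ‖w‖ := by
  rw [fderiv_prodFactor_apply f n hf]
  have hV : ∀ j : Fin n,
      (Pi.single (0 : Fin (n + 1)) w : Config (n + 1)) 0 -
        (Pi.single (0 : Fin (n + 1)) w : Config (n + 1)) j.succ = w := by
    intro j
    rw [Pi.single_eq_same, Pi.single_eq_of_ne (Fin.succ_ne_zero j), sub_zero]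
  simp_rw [hV]
  calc ‖∑ j : Fin n, (∏ i ∈ univ.erase j, f (X 0 - X i.succ)) * fderiv ℝ f (X 0 - X j.succ) w‖
      ≤ ∑ j : Fin n, ‖(∏ i ∈ univ.erase j, f (X 0 - X i.succ)) * fderiv ℝ f (X 0 - X j.succ) w‖ :=
        norm_sum_le _ _
    _ ≤ ∑ j : Fin n, (∏ i ∈ univ.erase j, f (X 0 - X i.succ)) * ((1 - f (X 0 - X j.succ)) * ‖w‖) :=
        Finset.sum_le_sum fun j _ => norm_term_le f n h01 hdf X j w
    _ = (∑ j : Fin n, (∏ i ∈ univ.erase j, f (X 0 - X i.succ)) * (1 - f (X 0 - X j.succ))) * ‖w‖ := by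
        rw [Finset.sum_mul]
        refine Finset.sum_congr rfl fun j _ => ?_
        ring
    _ ≤ (1 - ∏ j : Fin n, f (X 0 - X j.succ)) * ‖w‖ := by
        gcongr
        exact sum_prod_erase_mul_one_sub_le univ (fun j : Fin n => f (X 0 - X j.succ))
          fun j _ => h01 _

/-- Moving a frozen particle: `|DF(X) (Pi.single (j+1) w)| ≤ (1 − f(x₀ − x_{j+1})) ‖w‖`. [folklore] -/
theorem norm_fderiv_prodFactor_single_succ_le (hf : ContDiff ℝ 1 f) (h01 : ∀ z, 0 ≤ f z ∧ f z ≤ 1)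
    (hdf : ∀ z, ‖fderiv ℝ f z‖ ≤ 1 - f z) (X : Config (n + 1)) (j : Fin n) (w : Space) :
    ‖fderiv ℝ (fun X : Config (n + 1) => ∏ j : Fin n, f (X 0 - X j.succ)) X (Pi.single j.succ w)‖ ≤
      (1 - f (X 0 - X j.succ)) * ‖w‖ := by
  rw [fderiv_prodFactor_apply f n hf, Finset.sum_eq_single j]
  · rw [Pi.single_eq_same, Pi.single_eq_of_ne (Fin.succ_ne_zero j).symm, zero_sub, map_neg,
      mul_neg, norm_neg]
    have hP1 : ∏ i ∈ univ.erase j, f (X 0 - X i.succ) ≤ 1 :=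
      Finset.prod_le_one (fun i _ => (h01 _).1) fun i _ => (h01 _).2
    have hR : 0 ≤ (1 - f (X 0 - X j.succ)) * ‖w‖ :=
      mul_nonneg (sub_nonneg.2 (h01 _).2) (norm_nonneg _)
    calc ‖(∏ i ∈ univ.erase j, f (X 0 - X i.succ)) * fderiv ℝ f (X 0 - X j.succ) w‖
        ≤ (∏ i ∈ univ.erase j, f (X 0 - X i.succ)) * ((1 - f (X 0 - X j.succ)) * ‖w‖) :=
          norm_term_le f n h01 hdf X j w
      _ ≤ 1 * ((1 - f (X 0 - X j.succ)) * ‖w‖) := mul_le_mul_of_nonneg_right hP1 hR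
      _ = (1 - f (X 0 - X j.succ)) * ‖w‖ := one_mul _
  · intro i _ hij
    rw [Pi.single_eq_of_ne (Fin.succ_ne_zero j).symm,
      Pi.single_eq_of_ne fun h => hij (Fin.succ_inj.mp h), sub_zero, map_zero, mul_zero]
  · exact fun h => absurd (Finset.mem_univ j) h

end Calculus

end ProductJastrow

/-- **Registered stub `stub_productJastrow`** (PRODUCT JASTROW FACTOR): for a `C¹` one-body profile
`f : ℝ³ → [0,1]` with `‖∇f‖ ≤ 1 − f`, the factor `F(X) = ∏_{j<n} f(x₀ − x_{j+1})` on `Config (n+1)` is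
`C¹`, `0 ≤ F ≤ 1`, `|∂_{x₀} F · w| ≤ (1 − F)‖w‖`, `|∂_{x_{j+1}} F · w| ≤ (1 − f(x₀ − x_{j+1}))‖w‖`, and
`1 − F ≤ ∑_j (1 − f(x₀ − x_{j+1}))`. [folklore] -/
theorem stub_productJastrow :
    ∀ f : EuclideanSpace ℝ (Fin 3) → ℝ, ContDiff ℝ 1 f → (∀ z, 0 ≤ f z ∧ f z ≤ 1) →
      (∀ z, ‖fderiv ℝ f z‖ ≤ 1 - f z) →
      ∀ n : ℕ,
        ContDiff ℝ 1 (fun X : Literature.MathematicalPhysics.QuantumManyBody.BoseGas.Config (n + 1) =>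
          ∏ j : Fin n, f (X 0 - X j.succ)) ∧
        ∀ X : Literature.MathematicalPhysics.QuantumManyBody.BoseGas.Config (n + 1),
          (0 ≤ ∏ j : Fin n, f (X 0 - X j.succ) ∧ ∏ j : Fin n, f (X 0 - X j.succ) ≤ 1) ∧
          (∀ w : EuclideanSpace ℝ (Fin 3),
            ‖fderiv ℝ (fun X : Literature.MathematicalPhysics.QuantumManyBody.BoseGas.Config (n + 1) =>
                ∏ j : Fin n, f (X 0 - X j.succ)) X (Pi.single 0 w)‖ ≤
              (1 - ∏ j : Fin n, f (X 0 - X j.succ)) * ‖w‖) ∧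
          (∀ (j : Fin n) (w : EuclideanSpace ℝ (Fin 3)),
            ‖fderiv ℝ (fun X : Literature.MathematicalPhysics.QuantumManyBody.BoseGas.Config (n + 1) =>
                ∏ j : Fin n, f (X 0 - X j.succ)) X (Pi.single j.succ w)‖ ≤
              (1 - f (X 0 - X j.succ)) * ‖w‖) ∧
          (1 - ∏ j : Fin n, f (X 0 - X j.succ) ≤ ∑ j : Fin n, (1 - f (X 0 - X j.succ))) := by
  intro f hf h01 hdf n
  refine ⟨ProductJastrow.contDiff_prodFactor f n hf, fun X => ⟨⟨?_, ?_⟩, ?_, ?_, ?_⟩⟩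
  · exact Finset.prod_nonneg fun j _ => (h01 _).1
  · exact Finset.prod_le_one (fun j _ => (h01 _).1) fun j _ => (h01 _).2
  · exact fun w => ProductJastrow.norm_fderiv_prodFactor_single_zero_le f n hf h01 hdf X w
  · exact fun j w => ProductJastrow.norm_fderiv_prodFactor_single_succ_le f n hf h01 hdf X j w
  · exact ProductJastrow.one_sub_prod_le_sum univ (fun j : Fin n => f (X 0 - X j.succ))
      fun j _ => h01 _

end Summit.AtomisticToContinuum.BoseEinsteinCondensation.Cruxes.OneBodyEntropyBound.Birth

end
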